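import Summits.CriticalPhenomena.PercolationContinuityZ3.Theorems.PercNearOneGluingNoHeavyLowerTailCertGeneral
import HarnessLib

/-!
# `NoHeavyLowerTail` (stmt-CriticalPhenomena-4575) — certificate machine add-on: PRODUCT-FORM certificates
# (multipliers = products of linear forms; targets of any degree)

Support file (new-inequality factory, all-graph proof seat `prim-ineq-prove-4`; `--supports stmt-CriticalPhenomena-4575`).
Computable definitions + soundness; no named facts, no sorries, standard axioms.

The LP certificates of the `wf3lp` / `wf3sep` column generation (ttrl2, this seat) have the shape
      `M₀ · F  =  Σ_r λ_r · m_r · (E₃E₄ − E₁E₂)_r  +  Σ_h κ_h · m'_h · (E_hi − E_lo)_h  +  slack`,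
where every multiplier `m_r`, `m'_h` and every summand of `M₀` is a PRODUCT OF NAMED MASSES (linear forms in the cell
variables, e.g. `μ{a₂,a₃,o ↮ a₁} · μ{a₂,o ↮ a₁,a₃}`), and the target `F` may have any degree (EG₃: degree 1; the refined
Kozma–Nitzan residual `REFRES`: degree 4).  The checkers of `…CertCheck` / `…CertGeneral` take multipliers that are
monomials in the CELL variables and quadratic targets; expanding a product of masses into cell monomials off-line
multiplies the certificate data by the product of the mass sizes.  This file keeps the data compact and lets the kernel do
the expansion:
* `prodTerms fs mult wt` — the term list of `wt · x^mult · Π_{e ∈ fs} (Σ_{i∈e} x_i)` and `evalT_prodTerms`;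
* `PTerm` (signed product of linear forms), `PRow` (product row `E₁E₂ ≤ E₃E₄` with a product-of-forms multiplier),
  `PLinRow` (linear row `E_lo ≤ E_hi` with a product-of-forms multiplier), `pM0val` / `pval` (values of `M₀` and `F`);
* `checkP` / `checkPB` (bucketed) — coefficientwise domination of `M₀F⁻ + rows⁺ + lin⁺` by `M₀F⁺ + rows⁻ + lin⁻`,
  reusing `normalize` / `dominated` of `…CertCheck`;
* `soundP`, `soundP_of_buckets` — rows valid, linear rows valid, check passes ⇒ `0 ≤ pM0val · pval`;
  `pval_nonneg_of_pos` — hence `F ≥ 0` wherever `M₀ > 0`.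
-/

namespace Summit.CriticalPhenomena.PercolationContinuityZ3.Theorems

namespace CertCheck

/-! ## Expansion of products of linear forms -/

/-- The term list of `wt · x^mult · Π_{e ∈ fs} (Σ_{i ∈ e} x_i)`. [folklore] -/
def prodTerms : List (List ℕ) → List ℕ → ℕ → List Term
  | [], mult, wt => [(mult, wt)]
  | e :: fs, mult, wt => e.flatMap fun i => prodTerms fs (monoIns i mult) wt

/-- A signed product term `± coef · Π_{e ∈ factors} (Σ_{i∈e} x_i)`. [folklore] -/
structure PTerm where
  /-- the linear factors (cell lists) -/
  factors : List (List ℕ)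
  /-- natural coefficient -/
  coef : ℕ
  /-- sign: `true` = `+` -/
  pos : Bool
  deriving DecidableEq, Repr

/-- A product row `E₁E₂ ≤ E₃E₄` with multiplier `wt · Π mult`. [folklore] -/
structure PRow where
  /-- cells of `E₁` -/
  e1 : List ℕ
  /-- cells of `E₂` -/
  e2 : List ℕ
  /-- cells of `E₃` -/
  e3 : List ℕ
  /-- cells of `E₄` -/
  e4 : List ℕ
  /-- multiplier: product of linear forms -/
  mult : List (List ℕ)
  /-- weight -/
  wt : ℕ
  deriving DecidableEq, Repr

/-- A linear row `E_lo ≤ E_hi` with multiplier `wt · Π mult`. [folklore] -/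
structure PLinRow where
  /-- cells of the smaller side -/
  eLo : List ℕ
  /-- cells of the larger side -/
  eHi : List ℕ
  /-- multiplier: product of linear forms -/
  mult : List (List ℕ)
  /-- weight -/
  wt : ℕ
  deriving DecidableEq, Repr

/-- `M₀ × (the part of F with sign b)`, expanded. [folklore] -/
def pTargetTerms (M0 : List (List (List ℕ) × ℕ)) (F : List PTerm) (b : Bool) : List Term :=
  M0.flatMap fun p => (F.filter fun t => t.pos == b).flatMap fun t => prodTerms (t.factors ++ p.1) [] (p.2 * t.coef)

/-- Plus side: `M₀F⁻ + Σ rows E₃E₄·mult + Σ lin E_hi·mult`. [folklore] -/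
def pPlusTerms (M0 : List (List (List ℕ) × ℕ)) (F : List PTerm) (rows : List PRow) (lrows : List PLinRow) : List Term :=
  pTargetTerms M0 F false ++ (rows.flatMap fun r => prodTerms (r.e3 :: r.e4 :: r.mult) [] r.wt) ++
    lrows.flatMap fun r => prodTerms (r.eHi :: r.mult) [] r.wt

/-- Minus side: `M₀F⁺ + Σ rows E₁E₂·mult + Σ lin E_lo·mult`. [folklore] -/
def pMinusTerms (M0 : List (List (List ℕ) × ℕ)) (F : List PTerm) (rows : List PRow) (lrows : List PLinRow) : List Term :=
  pTargetTerms M0 F true ++ (rows.flatMap fun r => prodTerms (r.e1 :: r.e2 :: r.mult) [] r.wt) ++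
    lrows.flatMap fun r => prodTerms (r.eLo :: r.mult) [] r.wt

/-- THE PRODUCT-FORM CHECK. [folklore] -/
def checkP (M0 : List (List (List ℕ) × ℕ)) (F : List PTerm) (rows : List PRow) (lrows : List PLinRow) : Bool :=
  dominated (normalize (pPlusTerms M0 F rows lrows)) (normalize (pMinusTerms M0 F rows lrows))

/-- The bucketed product-form check (bucket `b` of `nb`). [folklore] -/
def checkPB (nb b : ℕ) (M0 : List (List (List ℕ) × ℕ)) (F : List PTerm) (rows : List PRow) (lrows : List PLinRow) : Bool :=
  dominated (normalize ((pPlusTerms M0 F rows lrows).filter fun t => bucket nb t == b))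
    (normalize ((pMinusTerms M0 F rows lrows).filter fun t => bucket nb t == b))

variable (x : ℕ → ℝ)

/-- Value of a product of linear forms. [folklore] -/
noncomputable def prodEval (fs : List (List ℕ)) : ℝ := (fs.map (linEval x)).prod

/-- Value of the signed target `F = Σ ± coef · Π`. [folklore] -/
noncomputable def pval (F : List PTerm) : ℝ :=
  (F.map fun t => (if t.pos then (t.coef : ℝ) else -(t.coef : ℝ)) * prodEval x t.factors).sum

/-- Value of `M₀ = Σ w · Π`. [folklore] -/
noncomputable def pM0val (M0 : List (List (List ℕ) × ℕ)) : ℝ := (M0.map fun p => (p.2 : ℝ) * prodEval x p.1).sum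

/-! ## Values of the expanded term lists -/

/-- `linEval` of a cons. [folklore] -/
theorem linEval_cons' (i : ℕ) (e : List ℕ) : linEval x (i :: e) = x i + linEval x e := by
  simp [linEval]

/-- Value of the inner flatMap of `prodTerms` over one linear factor. [folklore] -/
theorem evalT_flatMap_prodTerms (fs : List (List ℕ)) (mult : List ℕ) (wt : ℕ)
    (hfs : ∀ m, evalT x (prodTerms fs m wt) = (wt : ℝ) * evalM x m * prodEval x fs) :
    ∀ e : List ℕ, evalT x (e.flatMap fun i => prodTerms fs (monoIns i mult) wt) =
      (wt : ℝ) * evalM x mult * (linEval x e * prodEval x fs)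
  | [] => by simp [evalT, linEval]
  | i :: e => by
    rw [List.flatMap_cons, evalT_append, hfs, evalM_monoIns, linEval_cons',
      evalT_flatMap_prodTerms fs mult wt hfs e]
    ring

/-- **Value of `prodTerms`.** [folklore] -/
theorem evalT_prodTerms : ∀ (fs : List (List ℕ)) (mult : List ℕ) (wt : ℕ),
    evalT x (prodTerms fs mult wt) = (wt : ℝ) * evalM x mult * prodEval x fs
  | [], mult, wt => by simp [prodTerms, evalT, prodEval]
  | e :: fs, mult, wt => by
    have hfs : ∀ m, evalT x (prodTerms fs m wt) = (wt : ℝ) * evalM x m * prodEval x fs :=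
      fun m => evalT_prodTerms fs m wt
    have hprod : prodEval x (e :: fs) = linEval x e * prodEval x fs := by simp [prodEval]
    rw [hprod, prodTerms]
    exact evalT_flatMap_prodTerms x fs mult wt hfs e

/-- `prodEval` of a cons. [folklore] -/
theorem prodEval_cons (e : List ℕ) (fs : List (List ℕ)) : prodEval x (e :: fs) = linEval x e * prodEval x fs := by
  simp [prodEval]

/-- `prodEval` of an append. [folklore] -/
theorem prodEval_append (fs gs : List (List ℕ)) : prodEval x (fs ++ gs) = prodEval x fs * prodEval x gs := by
  simp [prodEval, List.map_append, List.prod_append]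

/-- `prodEval` is nonnegative at a nonnegative point. [folklore] -/
theorem prodEval_nonneg (hx : ∀ i, 0 ≤ x i) (fs : List (List ℕ)) : 0 ≤ prodEval x fs := by
  unfold prodEval
  apply List.prod_nonneg
  intro a ha
  rw [List.mem_map] at ha
  obtain ⟨e, _, rfl⟩ := ha
  exact linEval_nonneg x hx e

/-- Value of the expanded target side with sign `b`: `M₀ · F^b`. [folklore] -/
theorem evalT_pTargetTerms (M0 : List (List (List ℕ) × ℕ)) (F : List PTerm) (b : Bool) :
    evalT x (pTargetTerms M0 F b) =
      pM0val x M0 * ((F.filter fun t => t.pos == b).map fun t => (t.coef : ℝ) * prodEval x t.factors).sum := by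
  unfold pTargetTerms pM0val
  rw [evalT_flatMap]
  induction M0 with
  | nil => simp
  | cons p M0 ih =>
    rw [List.map_cons, List.sum_cons, ih, List.map_cons, List.sum_cons, add_mul]
    congr 1
    rw [evalT_flatMap]
    induction (F.filter fun t => t.pos == b) with
    | nil => simp
    | cons t ts ih2 =>
      rw [List.map_cons, List.sum_cons, ih2, List.map_cons, List.sum_cons, mul_add, evalT_prodTerms,
        prodEval_append]
      simp [evalM]
      ring

/-- Value of the expanded row sides. [folklore] -/
theorem evalT_rows_side (rows : List PRow) (sel : PRow → List ℕ × List ℕ) :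
    evalT x (rows.flatMap fun r => prodTerms ((sel r).1 :: (sel r).2 :: r.mult) [] r.wt) =
      (rows.map fun r => (r.wt : ℝ) * prodEval x r.mult * (linEval x (sel r).1 * linEval x (sel r).2)).sum := by
  rw [evalT_flatMap]
  congr 1
  refine List.map_congr_left fun r _ => ?_
  rw [evalT_prodTerms, prodEval_cons, prodEval_cons]
  simp [evalM]
  ring

/-- Value of the expanded linear-row sides. [folklore] -/
theorem evalT_lrows_side (lrows : List PLinRow) (sel : PLinRow → List ℕ) :
    evalT x (lrows.flatMap fun r => prodTerms (sel r :: r.mult) [] r.wt) =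
      (lrows.map fun r => (r.wt : ℝ) * prodEval x r.mult * linEval x (sel r)).sum := by
  rw [evalT_flatMap]
  congr 1
  refine List.map_congr_left fun r _ => ?_
  rw [evalT_prodTerms, prodEval_cons]
  simp [evalM]
  ring

/-- `F = F⁺ − F⁻` in terms of the sign filters. [folklore] -/
theorem pval_eq (F : List PTerm) :
    pval x F = ((F.filter fun t => t.pos == true).map fun t => (t.coef : ℝ) * prodEval x t.factors).sum -
      ((F.filter fun t => t.pos == false).map fun t => (t.coef : ℝ) * prodEval x t.factors).sum := by
  unfold pval
  induction F with
  | nil => simp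
  | cons t F ih =>
    rw [List.map_cons, List.sum_cons, ih, List.filter_cons, List.filter_cons]
    cases ht : t.pos
    · simp
      ring
    · simp
      ring

/-! ## Soundness -/

/-- From the values: domination of the expanded sides + valid rows ⇒ `0 ≤ M₀ · F`. [folklore] -/
theorem le_of_evalT_P_le (hx : ∀ i, 0 ≤ x i) (M0 : List (List (List ℕ) × ℕ)) (F : List PTerm)
    (rows : List PRow) (lrows : List PLinRow)
    (hrows : ∀ r ∈ rows, linEval x r.e1 * linEval x r.e2 ≤ linEval x r.e3 * linEval x r.e4)
    (hlrows : ∀ r ∈ lrows, linEval x r.eLo ≤ linEval x r.eHi)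
    (hdom : evalT x (pPlusTerms M0 F rows lrows) ≤ evalT x (pMinusTerms M0 F rows lrows)) :
    0 ≤ pM0val x M0 * pval x F := by
  unfold pPlusTerms pMinusTerms at hdom
  rw [evalT_append, evalT_append, evalT_append, evalT_append, evalT_pTargetTerms, evalT_pTargetTerms,
    evalT_rows_side x rows (fun r => (r.e3, r.e4)), evalT_rows_side x rows (fun r => (r.e1, r.e2)),
    evalT_lrows_side x lrows (fun r => r.eHi), evalT_lrows_side x lrows (fun r => r.eLo)] at hdom
  have hR : (rows.map fun r => (r.wt : ℝ) * prodEval x r.mult * (linEval x r.e1 * linEval x r.e2)).sum ≤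
      (rows.map fun r => (r.wt : ℝ) * prodEval x r.mult * (linEval x r.e3 * linEval x r.e4)).sum := by
    apply List.sum_le_sum
    intro r hr
    exact mul_le_mul_of_nonneg_left (hrows r hr) (mul_nonneg (Nat.cast_nonneg _) (prodEval_nonneg x hx _))
  have hL : (lrows.map fun r => (r.wt : ℝ) * prodEval x r.mult * linEval x r.eLo).sum ≤
      (lrows.map fun r => (r.wt : ℝ) * prodEval x r.mult * linEval x r.eHi).sum := by
    apply List.sum_le_sum
    intro r hr
    exact mul_le_mul_of_nonneg_left (hlrows r hr) (mul_nonneg (Nat.cast_nonneg _) (prodEval_nonneg x hx _))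
  rw [pval_eq, mul_sub]
  simp only at hdom
  linarith

/-- **Soundness of the product-form check.** [folklore] -/
theorem soundP (hx : ∀ i, 0 ≤ x i) (M0 : List (List (List ℕ) × ℕ)) (F : List PTerm)
    (rows : List PRow) (lrows : List PLinRow)
    (hrows : ∀ r ∈ rows, linEval x r.e1 * linEval x r.e2 ≤ linEval x r.e3 * linEval x r.e4)
    (hlrows : ∀ r ∈ lrows, linEval x r.eLo ≤ linEval x r.eHi)
    (h : checkP M0 F rows lrows = true) : 0 ≤ pM0val x M0 * pval x F := by
  have hdom := evalT_le_of_dominated x hx _ _ h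
  rw [evalT_normalize, evalT_normalize] at hdom
  exact le_of_evalT_P_le x hx M0 F rows lrows hrows hlrows hdom

/-- **Soundness of the bucketed product-form check.** [folklore] -/
theorem soundP_of_buckets (hx : ∀ i, 0 ≤ x i) (M0 : List (List (List ℕ) × ℕ)) (F : List PTerm)
    (rows : List PRow) (lrows : List PLinRow) {nb : ℕ} (hnb : 0 < nb)
    (hrows : ∀ r ∈ rows, linEval x r.e1 * linEval x r.e2 ≤ linEval x r.e3 * linEval x r.e4)
    (hlrows : ∀ r ∈ lrows, linEval x r.eLo ≤ linEval x r.eHi)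
    (h : ∀ b < nb, checkPB nb b M0 F rows lrows = true) : 0 ≤ pM0val x M0 * pval x F := by
  have hdom : evalT x (pPlusTerms M0 F rows lrows) ≤ evalT x (pMinusTerms M0 F rows lrows) := by
    rw [evalT_eq_sum_buckets x hnb (pPlusTerms M0 F rows lrows),
      evalT_eq_sum_buckets x hnb (pMinusTerms M0 F rows lrows)]
    apply List.sum_le_sum
    intro b hb
    have hc := h b (List.mem_range.1 hb)
    have := evalT_le_of_dominated x hx _ _ hc
    rwa [evalT_normalize, evalT_normalize] at this
  exact le_of_evalT_P_le x hx M0 F rows lrows hrows hlrows hdom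

/-- `M₀ ≥ 0` at a nonnegative point. [folklore] -/
theorem pM0val_nonneg (hx : ∀ i, 0 ≤ x i) (M0 : List (List (List ℕ) × ℕ)) : 0 ≤ pM0val x M0 := by
  unfold pM0val
  apply List.sum_nonneg
  intro a ha
  rw [List.mem_map] at ha
  obtain ⟨p, _, rfl⟩ := ha
  exact mul_nonneg (Nat.cast_nonneg _) (prodEval_nonneg x hx _)

/-- `M₀ · F ≥ 0` and `M₀ > 0` give `F ≥ 0`. [folklore] -/
theorem pval_nonneg_of_pos (M0 : List (List (List ℕ) × ℕ)) (F : List PTerm)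
    (hMF : 0 ≤ pM0val x M0 * pval x F) (hM : 0 < pM0val x M0) : 0 ≤ pval x F := by
  by_contra h
  have h' : pval x F < 0 := lt_of_not_ge h
  have := mul_neg_of_pos_of_neg hM h'
  linarith

/-! ## A toy instance (sanity check of the data format, by `decide`) -/

/-- Toy certificate: from the product row `x₀·x₁ ≤ x₂·x₂` (as `E₁=[0],E₂=[1],E₃=[2],E₄=[2]`) with multiplier
`(x₀+x₁)`, the linear row `x₁ ≤ x₀` with multiplier `(x₂)(x₂)`, derive `M₀·F` with `M₀ = (x₀+x₁)` and
`F = x₂x₂ − x₀x₁` — the check passes. [folklore] -/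
example : checkP [([[0, 1]], 1)] [⟨[[2], [2]], 1, true⟩, ⟨[[0], [1]], 1, false⟩]
    [⟨[0], [1], [2], [2], [[0, 1]], 1⟩] [] = true := by decide

end CertCheck

end Summit.CriticalPhenomena.PercolationContinuityZ3.Theorems
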